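import Summits.CriticalPhenomena.PercolationContinuityZ3.Theorems.PercNearOneGluingNoHeavyLowerTailSahiCTCN3FiveEnum
import HarnessLib

/-!
# `NoHeavyLowerTail` (crux stmt-CriticalPhenomena-4575), P3 lane: the level-3 certificate on five points — FINITE CHECK, part 3 of 5

Support file (seat `prim-l12-p3`, gen 21; `--supports stmt-CriticalPhenomena-4575`; `--computational`: one `native_decide`).  Memo
`run/shared/lean/prim/prim-l12/FROM-prim-l12-p3-g21-*.md`.  `…SahiCTCN3FiveEnum.checkAll3 3` runs the coded enumeration of all valid level-3
configurations on `Fin 5` and, for the canonical ones of part 3 (≈ 400 of the 1 989 orbit representatives), checks that the 3125-entry coefficient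
table of `Ñ₃` is entrywise `≥ 0`.  The five parts are assembled in `…SahiCTCN3Five`.  Nothing is asserted about the crux.
-/

namespace Summit.CriticalPhenomena.PercolationContinuityZ3.Theorems.SahiCTCForms.N3Five

/-- **THE FINITE CHECK, part 3 of 5.** [this work] -/
theorem checkAll3_3 : checkAll3 3 = true := by native_decide

end Summit.CriticalPhenomena.PercolationContinuityZ3.Theorems.SahiCTCForms.N3Five
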